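import Literature.IUT.LogVolume.DifferentConductorTower
import Literature.NumberTheory.NumberFields.RamifiedPrimesDifferentBound
import HarnessLib

/-!
# [IUTchIV] Theorem 1.10, Step (iii), for REAL towers of number fields: the distinguished primes,
# `log(𝔰^ℚ) ≤ 2·d_mod·(log(𝔡^{F_tpd}) + log(𝔣^{F_tpd})) + log(2·3·5·l)`

Mochizuki, *Inter-universal Teichmüller theory IV*, RIMS manuscript (Apr. 2020; = PRIMS **57** (2021)),
Theorem 1.10, proof Step (iii), pp. 24–26 (kurims `paper:url-56bcb0f95768`). With `F_mod ⊆ F_tpd`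
(`d_mod = [F_mod : ℚ]`), the distinguished rational primes `𝕍_ℚ^dst` are characterised by (D4) ⟺ (D5) ⟺ (D6):
"Either `p_{v_ℚ} | 2·3·5·l` or `v_ℚ` lies in the image of `Supp(𝔮^{F_tpd}_ADiv + 𝔡^{F_tpd}_ADiv)`", and p. 26:
"it follows immediately from Proposition 1.3, (i), by considering the various possibilities for elements
`∈ Supp(𝔰^{F_mod}_ADiv)`, that `log(𝔰^{F_mod}_{v_ℚ}) ≤ 2·(log(𝔡^{F_tpd}_{v_ℚ}) + log(𝔣^{F_tpd}_{v_ℚ}))` … we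
conclude that `log(𝔰^ℚ) ≤ 2·d_mod·(log(𝔡^{F_tpd}) + log(𝔣^{F_tpd})) + log(2·3·5·l)`".

The tree's `Theorem110StepIIITower.lean` (abc-iut-S3) checks this assembly over abstract place data
(`Thm110StepIII.StepIIITower.logsQ_le`), and `Theorem110Data.lean` carries it as the named hypothesis `sQ_le`
of `Thm110Numerics.ProofData`. THIS FILE proves it for ACTUAL number fields `F ⊆ K` (read `F_mod ⊆ F_tpd`)
in the arithmetic-divisor vocabulary of `DifferentConductorTower.lean` (`𝔡^K_ADiv = differentDivisor K`,
`𝔣^K_ADiv = ADivisor.reduced T` with `T` the places of `K` over the bad places `S` of `F`, `deg = ndeg`):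

* `half_finrank_mul_log_le_sum_fibre` — **the local inequality behind the factor `2`**: a place `v` of `F`
  with residue characteristic `q` which is bad, or above which every place of `K` is ramified over `ℚ`,
  makes the places `w | v` contribute `≥ ([K:F]/2)·log q` to `[K:ℚ]·(deg(𝔡^K) + deg(𝔣^K))` (bad:
  `ord_w 𝔡_{K/ℚ} + 1 ≥ e(w|q) ≥ e(w|v)` and `Σ_{w|v} e(w|v)·log N(w) = [K:F]·log N(v)`; ramified:
  `ord_w 𝔡_{K/ℚ} ≥ e(w|q) - 1 ≥ e(w|q)/2` — Dedekind's bound, the absolute form of Prop. 1.3 (i));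
* `sum_log_distinguished_le` — **Step (iii) as printed, for actual fields**: if every `q ∈ dst` divides
  `2·3·5·l` or lies under such a place `v` (the (D6) alternative, conjugate places of the Galois extension
  `F_tpd/F_mod` ramifying together), then
  `Σ_{q ∈ dst} log q ≤ 2·[F:ℚ]·(deg(𝔡^K_ADiv) + deg(𝔣^K_ADiv)) + log(2·3·5·l)` — the shape of `sQ_le` with
  `d_mod = [F:ℚ]` the BOTTOM degree (the faithful reading of the TIER-2-corrected `StepIIITower`).

With `DifferentConductorTower(Bounds).lean` this makes all four different/conductor fields of `ProofData`
(`tpd_le_F`, `F_le`, `K_le`, `sQ_le`) theorems about real number fields modulo exactly the printed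
E-dependent inputs (here: (D6)). Classical algebraic number theory; nothing here takes a side on Cor. 3.12.
-/

noncomputable section

namespace Literature.IUT.LogVolume

open NumberField IsDedekindDomain Finset
open Literature.NumberTheory.NumberFields (pow_ramificationIdx_sub_one_dvd_differentIdeal
  ramificationIdx_rel_dvd_ramificationIdx_int)
open scoped Classical

variable (F K : Type*) [Field F] [NumberField F] [Field K] [NumberField K] [Algebra F K]

/-! ### Per-place facts for the absolute different `𝔡_{K/ℚ}` -/

section Absolute

variable {F K}

omit [NumberField F] [NumberField K] in
/-- The residue characteristic of a place of `K` is that of the place of `F` below it.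
[cite: Mochizuki2012, IUTchIV Def. 1.9 p. 21] -/
theorem residueChar_finBelow (w : HeightOneSpectrum (𝓞 K)) :
    residueChar F (finBelow F K w) = residueChar K w := by
  simp only [residueChar, finBelow]
  rw [Ideal.under_under]

/-- `e(w | p_w) - 1 ≤ ord_w 𝔡_{K/ℚ}` (Dedekind, absolute form; the tree's
`pow_ramificationIdx_sub_one_dvd_differentIdeal`). [cite: NeukirchANT1999, Ch. III (2.6)] -/
theorem ramificationIdx_int_sub_one_le_multiplicity (w : HeightOneSpectrum (𝓞 K)) :
    w.asIdeal.ramificationIdx ℤ - 1 ≤ multiplicity w.asIdeal (differentIdeal ℤ (𝓞 K)) := by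
  haveI : w.asIdeal.IsMaximal := w.isMaximal
  exact (FiniteMultiplicity.of_prime_left (Ideal.prime_of_isPrime w.ne_bot inferInstance)
    (differentIdeal_ne_bot' K)).le_multiplicity_of_pow_dvd
      (pow_ramificationIdx_sub_one_dvd_differentIdeal K w.asIdeal)

/-- The coefficient of the different divisor `𝔡^K_ADiv` at `w` is `ord_w 𝔡_{K/ℚ}`.
[cite: MochizukiGenEll2010, Def. 1.5 (iii) p.9] -/
theorem differentDivisor_apply_inr (w : HeightOneSpectrum (𝓞 K)) :
    differentDivisor K (Sum.inr w) = (multiplicity w.asIdeal (differentIdeal ℤ (𝓞 K)) : ℝ) :=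
  ADivisor.ofIdeal_apply_inr (differentIdeal_ne_bot' K) w

/-- The places of `K` over a finite place `v` of `F`, as a finite set of finite places (the fibre of
`finBelow`; `placesAbove F K (inr v)` is its image in `𝕍(K)`). [cite: Mochizuki2012, IUTchIV Def. 1.9 (ii) p. 22] -/
theorem mem_preimage_primesOverFinset_iff (v : HeightOneSpectrum (𝓞 F)) (w : HeightOneSpectrum (𝓞 K)) :
    w ∈ (IsDedekindDomain.primesOverFinset v.asIdeal (𝓞 K)).preimage HeightOneSpectrum.asIdeal
      (fun _ _ _ _ h => HeightOneSpectrum.ext h) ↔ finBelow F K w = v := by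
  have h := mem_placesAbove_iff (F := F) (K := K) (Sum.inr v) (Sum.inr w)
  simp only [placesAbove, Finset.mem_map, Function.Embedding.coeFn_mk, Sum.inr.injEq, exists_eq_right,
    Place.below, Sum.map_inr] at h
  exact h

end Absolute

/-! ### The bound on the distinguished primes -/

section Distinguished

/-- The primes of a finite set of primes that divide `N > 0` have `Σ log q ≤ log N`.
[cite: Mochizuki2012, IUTchIV Thm. 1.10 Step (iii) p. 26] -/
theorem sum_log_filter_dvd_le_log (dst : Finset ℕ) (hdst : ∀ q ∈ dst, q.Prime) {N : ℕ} (hN : 0 < N) :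
    ∑ q ∈ dst.filter (fun q => q ∣ N), Real.log q ≤ Real.log N := by
  have hdvd : ∏ q ∈ dst.filter (fun q => q ∣ N), q ∣ N :=
    Finset.prod_primes_dvd _ (fun q hq => (hdst q (Finset.mem_filter.mp hq).1).prime)
      (fun q hq => (Finset.mem_filter.mp hq).2)
  have hle : ((∏ q ∈ dst.filter (fun q => q ∣ N), q : ℕ) : ℝ) ≤ N := by
    exact_mod_cast Nat.le_of_dvd hN hdvd
  have hpos : ∀ q ∈ dst.filter (fun q => q ∣ N), (0 : ℝ) < q := fun q hq => by
    exact_mod_cast (hdst q (Finset.mem_filter.mp hq).1).pos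
  rw [← Real.log_prod (fun q hq => (hpos q hq).ne')]
  push_cast at hle ⊢
  exact Real.log_le_log (Finset.prod_pos hpos) hle

/-- **The local inequality behind the factor `2`** (p. 26: "by considering the various possibilities for
elements `∈ Supp(𝔰^{F_mod}_ADiv)`"), for ACTUAL number fields `F ⊆ K` (`[K:F] = n`): let `v` be a finite
place of `F` with residue characteristic `q`, and suppose EITHER `v` is bad (`v ∈ S`) OR every place `w` of
`K` over `v` is ramified over `ℚ` (`e(w|q) ≥ 2`). Then the places `w | v` contribute at least `(n/2)·log q` to
`[K:ℚ]·(deg(𝔡^K_ADiv) + deg(𝔣^K_ADiv))`: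
`(n/2)·log q ≤ Σ_{w|v} (ord_w 𝔡_{K/ℚ}·log N(w) + [w ∈ T]·log N(w))` — bad: `ord_w 𝔡_{K/ℚ} + 1 ≥ e(w|q) ≥ e(w|v)`
and `Σ_{w|v} e(w|v)·log N(w) = n·log N(v) ≥ n·log q`; ramified: `ord_w 𝔡_{K/ℚ} ≥ e(w|q) - 1 ≥ e(w|q)/2 ≥
e(w|v)/2`. [claim: Mochizuki2012, status: disputed] -/
theorem half_finrank_mul_log_le_sum_fibre (S : Finset (HeightOneSpectrum (𝓞 F)))
    (T : Finset (HeightOneSpectrum (𝓞 K))) (hT : ∀ w, w ∈ T ↔ finBelow F K w ∈ S)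
    (v : HeightOneSpectrum (𝓞 F))
    (hv : v ∈ S ∨ ∀ w : HeightOneSpectrum (𝓞 K), finBelow F K w = v → 2 ≤ w.asIdeal.ramificationIdx ℤ) :
    (Module.finrank F K : ℝ) / 2 * Real.log (residueChar F v) ≤
      ∑ w ∈ (IsDedekindDomain.primesOverFinset v.asIdeal (𝓞 K)).preimage HeightOneSpectrum.asIdeal
          (fun _ _ _ _ h => HeightOneSpectrum.ext h),
        (differentDivisor K (Sum.inr w) * logNorm K w + if w ∈ T then logNorm K w else 0) := by
  set W := (IsDedekindDomain.primesOverFinset v.asIdeal (𝓞 K)).preimage HeightOneSpectrum.asIdeal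
    (fun _ _ _ _ h => HeightOneSpectrum.ext h) with hWdef
  -- `Σ_{w|v} e(w|v)·log N(w) = n·log N(v)`
  have hfund : ∑ w ∈ W, (pullbackWeight F K (Sum.inr w) : ℝ) * logNorm K w =
      Module.finrank F K * logNorm F v := by
    have h := sum_pullbackWeight_mul_degWeight_inr (F := F) (K := K) v
    rw [degWeight_inr, placesAbove, Finset.sum_map] at h
    exact h
  -- `log N(v) ≥ log q ≥ 0`
  have hq0 : 0 ≤ Real.log (residueChar F v) :=
    Real.log_nonneg (by exact_mod_cast (residueChar_prime F v).one_lt.le)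
  have hNv : Real.log (residueChar F v) ≤ logNorm F v := by
    rw [logNorm_eq F v]
    have : (1 : ℝ) ≤ resDeg F v := by exact_mod_cast Nat.one_le_iff_ne_zero.mpr (resDeg_ne_zero F v)
    nlinarith
  have hn : (0 : ℝ) ≤ Module.finrank F K := Nat.cast_nonneg _
  -- per-place comparison `e(w|v) ≤ e(w|q) ≤ ord_w 𝔡_{K/ℚ} + 1`
  have hew : ∀ w ∈ W, (pullbackWeight F K (Sum.inr w) : ℝ) ≤ w.asIdeal.ramificationIdx ℤ ∧
      ((w.asIdeal.ramificationIdx ℤ : ℝ) - 1 ≤ differentDivisor K (Sum.inr w)) := by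
    intro w _
    haveI : w.asIdeal.IsMaximal := w.isMaximal
    rw [pullbackWeight_inr_eq, differentDivisor_apply_inr]
    refine ⟨?_, ?_⟩
    · exact_mod_cast Nat.le_of_dvd (Ideal.ramificationIdx_pos w.asIdeal ℤ)
        (ramificationIdx_rel_dvd_ramificationIdx_int F K w.asIdeal)
    · have h := ramificationIdx_int_sub_one_le_multiplicity (K := K) w
      have h1 : 1 ≤ w.asIdeal.ramificationIdx ℤ := Ideal.ramificationIdx_pos w.asIdeal ℤ
      rw [← Nat.cast_one, ← Nat.cast_sub h1]
      exact_mod_cast h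
  rcases hv with hbad | hram
  · -- bad: every `w | v` is in `T`
    have hwT : ∀ w ∈ W, w ∈ T := fun w hw =>
      (hT w).mpr (((mem_preimage_primesOverFinset_iff v w).mp hw).symm ▸ hbad)
    calc (Module.finrank F K : ℝ) / 2 * Real.log (residueChar F v)
        ≤ Module.finrank F K * logNorm F v := by nlinarith
      _ = ∑ w ∈ W, (pullbackWeight F K (Sum.inr w) : ℝ) * logNorm K w := hfund.symm
      _ ≤ _ := Finset.sum_le_sum fun w hw => by
          rw [if_pos (hwT w hw)]
          obtain ⟨h1, h2⟩ := hew w hw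
          have hl := (logNorm_pos K w).le
          nlinarith
  · -- all `w | v` ramified over `ℚ`: `ord_w ≥ e(w|q) - 1 ≥ e(w|q)/2 ≥ e(w|v)/2`
    calc (Module.finrank F K : ℝ) / 2 * Real.log (residueChar F v)
        ≤ (Module.finrank F K * logNorm F v) / 2 := by nlinarith
      _ = (∑ w ∈ W, (pullbackWeight F K (Sum.inr w) : ℝ) * logNorm K w) / 2 := by rw [hfund]
      _ = ∑ w ∈ W, (pullbackWeight F K (Sum.inr w) : ℝ) * logNorm K w / 2 := by rw [Finset.sum_div]
      _ ≤ _ := Finset.sum_le_sum fun w hw => by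
          obtain ⟨h1, h2⟩ := hew w hw
          have he2 : (2 : ℝ) ≤ w.asIdeal.ramificationIdx ℤ := by
            exact_mod_cast hram w ((mem_preimage_primesOverFinset_iff v w).mp hw)
          have hl := (logNorm_pos K w).le
          have hif : 0 ≤ (if w ∈ T then logNorm K w else 0) := by split_ifs <;> [exact hl; exact le_rfl]
          nlinarith

/-- **[IUTchIV] Thm. 1.10, Step (iii), the bound on `log(𝔰^ℚ)`, for ACTUAL number fields** (p. 26:
"`log(𝔰^ℚ) ≤ 2·d_mod·(log(𝔡^{F_tpd}) + log(𝔣^{F_tpd})) + log(2·3·5·l)`"; the field `sQ_le` of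
`Thm110Numerics.ProofData`, cf. `Thm110StepIII.StepIIITower.logsQ_le` over abstract place data): for number
fields `F ⊆ K` (read `F_mod ⊆ F_tpd`), bad places `S` of `F`, `T` the places of `K` over `S`, `l ≥ 1`, and a
finite set `dst` of primes such that every `q ∈ dst` either divides `2·3·5·l` or lies under a place `v` of `F`
that is bad or above which every place of `K` is ramified over `ℚ` (the printed (D6): "either `p_{v_ℚ} | 2·3·5·l`
or `v_ℚ` lies in the image of `Supp(𝔮^{F_tpd}_ADiv + 𝔡^{F_tpd}_ADiv)`", conjugate places of the Galois
extension `F_tpd/F_mod` ramifying together):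
`Σ_{q ∈ dst} log q ≤ 2·[F:ℚ]·(deg(𝔡^K_ADiv) + deg(𝔣^K_ADiv)) + log(2·3·5·l)`.
[claim: Mochizuki2012, status: disputed] -/
theorem sum_log_distinguished_le (S : Finset (HeightOneSpectrum (𝓞 F)))
    (T : Finset (HeightOneSpectrum (𝓞 K))) (hT : ∀ w, w ∈ T ↔ finBelow F K w ∈ S)
    {l : ℕ} (hl : 0 < l) (dst : Finset ℕ) (hdst : ∀ q ∈ dst, q.Prime)
    (D6 : ∀ q ∈ dst, q ∣ 2 * 3 * 5 * l ∨ ∃ v : HeightOneSpectrum (𝓞 F), residueChar F v = q ∧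
      (v ∈ S ∨ ∀ w : HeightOneSpectrum (𝓞 K), finBelow F K w = v → 2 ≤ w.asIdeal.ramificationIdx ℤ)) :
    ∑ q ∈ dst, Real.log q ≤
      2 * Module.finrank ℚ F * (ndeg K (differentDivisor K) + ndeg K (ADivisor.reduced T)) +
        Real.log (2 * 3 * 5 * (l : ℝ)) := by
  have hF : (0 : ℝ) < Module.finrank ℚ F := by exact_mod_cast Module.finrank_pos
  have hKF : (0 : ℝ) < Module.finrank F K := by exact_mod_cast Module.finrank_pos
  -- split off the primes dividing `2·3·5·l`
  rw [← Finset.sum_filter_add_sum_filter_not dst (fun q => q ∣ 2 * 3 * 5 * l)]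
  have h1 : ∑ q ∈ dst.filter (fun q => q ∣ 2 * 3 * 5 * l), Real.log q ≤ Real.log (2 * 3 * 5 * (l : ℝ)) := by
    have h := sum_log_filter_dvd_le_log dst hdst (N := 2 * 3 * 5 * l) (by omega)
    have e : ((2 * 3 * 5 * l : ℕ) : ℝ) = 2 * 3 * 5 * (l : ℝ) := by push_cast; ring
    rwa [e] at h
  -- the other primes, against `A = [K:ℚ]·(deg 𝔡^K + deg 𝔣^K)` written as a sum over a finite set `D`
  set dst' := dst.filter (fun q => ¬ q ∣ 2 * 3 * 5 * l) with hdst'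
  set D : Finset (HeightOneSpectrum (𝓞 K)) :=
    T ∪ (differentDivisor K).support.preimage Sum.inr (Sum.inr_injective.injOn) ∪ dst.biUnion (placesOver K)
    with hDdef
  set g : HeightOneSpectrum (𝓞 K) → ℝ := fun w =>
    differentDivisor K (Sum.inr w) * logNorm K w + if w ∈ T then logNorm K w else 0 with hgdef
  have hg0 : ∀ w, 0 ≤ g w := fun w => by
    have hl := (logNorm_pos K w).le
    refine add_nonneg (mul_nonneg (differentDivisor_isEffective K _) hl) ?_
    split_ifs <;> [exact hl; exact le_rfl]
  have hA : degF K (differentDivisor K) + degF K (ADivisor.reduced T) = ∑ w ∈ D, g w := by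
    rw [degF_eq_sum_of_subset K (differentDivisor K) D (fun w => ADivisor.ofIdeal_apply_inl _ w) (fun w hw => by
        rw [hDdef, Finset.mem_union, Finset.mem_union, Finset.mem_preimage]
        exact Or.inl (Or.inr (Finsupp.mem_support_iff.mpr hw))),
      ADivisor.degF_reduced_eq_sum, hgdef, Finset.sum_add_distrib, ← Finset.sum_filter]
    congr 1
    refine Finset.sum_congr ?_ fun _ _ => rfl
    ext w
    simp only [Finset.mem_filter, hDdef, Finset.mem_union]
    tauto
  -- per distinguished prime
  have hq : ∀ q ∈ dst', (Module.finrank F K : ℝ) / 2 * Real.log q ≤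
      ∑ w ∈ D.filter (fun w => residueChar K w = q), g w := by
    intro q hq
    obtain ⟨hqd, hnd⟩ := Finset.mem_filter.mp hq
    haveI : Fact q.Prime := ⟨hdst q hqd⟩
    rcases D6 q hqd with h | ⟨v, hvq, hv⟩
    · exact absurd h hnd
    have hloc := half_finrank_mul_log_le_sum_fibre F K S T hT v hv
    rw [hvq] at hloc
    refine hloc.trans (Finset.sum_le_sum_of_subset_of_nonneg (fun w hw => ?_) (fun w _ _ => hg0 w))
    have hwv := (mem_preimage_primesOverFinset_iff v w).mp hw
    have hres : residueChar K w = q := by rw [← residueChar_finBelow (F := F) w, hwv, hvq]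
    refine Finset.mem_filter.mpr ⟨?_, hres⟩
    rw [hDdef, Finset.mem_union]
    exact Or.inr (Finset.mem_biUnion.mpr ⟨q, hqd, (mem_placesOver_iff_residueChar w).mpr hres⟩)
  have h2 : (Module.finrank F K : ℝ) / 2 * ∑ q ∈ dst', Real.log q ≤ ∑ w ∈ D, g w := by
    rw [Finset.mul_sum]
    calc ∑ q ∈ dst', (Module.finrank F K : ℝ) / 2 * Real.log q
        ≤ ∑ q ∈ dst', ∑ w ∈ D.filter (fun w => residueChar K w = q), g w := Finset.sum_le_sum hq
      _ = ∑ w ∈ D.filter (fun w => residueChar K w ∈ dst'), g w := by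
          rw [← Finset.sum_fiberwise_of_maps_to (s := D.filter (fun w => residueChar K w ∈ dst')) (t := dst')
            (g := fun w => residueChar K w) (fun w hw => (Finset.mem_filter.mp hw).2) g]
          refine Finset.sum_congr rfl fun q hq' => Finset.sum_congr ?_ fun _ _ => rfl
          ext w
          simp only [Finset.mem_filter]
          constructor
          · rintro ⟨hD, h⟩; exact ⟨⟨hD, h ▸ hq'⟩, h⟩
          · rintro ⟨⟨hD, _⟩, h⟩; exact ⟨hD, h⟩
      _ ≤ ∑ w ∈ D, g w :=
          Finset.sum_le_sum_of_subset_of_nonneg (Finset.filter_subset _ _) fun w _ _ => hg0 w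
  -- assemble: `A = [K:F]·[F:ℚ]·(deg 𝔡^K + deg 𝔣^K)`
  have h3 : ∑ q ∈ dst', Real.log q ≤
      2 * Module.finrank ℚ F * (ndeg K (differentDivisor K) + ndeg K (ADivisor.reduced T)) := by
    rw [ndeg_apply K (differentDivisor K), ndeg_apply K (ADivisor.reduced T), ← add_div, hA,
      finrank_rat_eq_mul (F := F) (K := K)]
    have e : 2 * (Module.finrank ℚ F : ℝ) * ((∑ w ∈ D, g w) / (Module.finrank F K * Module.finrank ℚ F)) =
        2 / Module.finrank F K * ∑ w ∈ D, g w := by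
      field_simp
    rw [e]
    have h2' := mul_le_mul_of_nonneg_left h2 (show (0 : ℝ) ≤ 2 / Module.finrank F K by positivity)
    have e2 : 2 / (Module.finrank F K : ℝ) * ((Module.finrank F K : ℝ) / 2 * ∑ q ∈ dst', Real.log q) =
        ∑ q ∈ dst', Real.log q := by
      field_simp
    linarith
  linarith

end Distinguished

end Literature.IUT.LogVolume

end
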